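import Summits.QuantumFields.YangMills.Theorems.LuscherReductionTwistedTraceScalingStepKernelChart
import Summits.QuantumFields.YangMills.Theorems.LuscherReductionTwistedTraceScalingChartTransport
import HarnessLib

/-!
# The transfer kernel along a near step as a PURE GAUSSIAN MODEL in the link-space variable `x = chartVec y`
# (covariant programme, brick c4(iii)-step III)

Cell `ym-fleet`, crux `TwistedTraceScaling` (stmt-QuantumFields-20203), line «twolattice», stub S-BASE, lane B = COARSE-LOWER(L₁)
(design note `pub/ym-fleet/ym-20203-coarse-s1/LOWER-BLUEPRINT.md` §5–§6, c4(iii)).  HONEST FRAMING: fixed-lattice bookkeeping; a stub of a child of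
the CONDITIONAL reduction route (femto rung R2b1); not a gap, not Clay.

`…StepKernelChart` sandwiches `K_β(U, P(y)·U)` by a Gaussian in the gnomonic coordinate `y` (kinetic factor) times the magnetic model in
`G = F(U) + D_U(linkVec P(y))`, where `linkVec P(y) = s·y` (`s_e = (1+|y_e|²)^{−1/2}`) is the VECTOR-PART coordinate.  This file removes the
mismatch: on the chart ball `|y_e| ≤ ρ` one has `|s_e y_e − y_e| ≤ ρ³/2`, so with the single link-space variable `x = chartVec y ∈ LinkSpace L`
(`‖x‖² = Σ|y_e|²`, `GnChart.norm_chartVec_sq`; `y ↦ chartVec y` is volume preserving, `GnChart.volume_preserving_chartVec`):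

* `one_sub_scalarPart_gnoPoint_le` — `1 − s ≤ |y|²/2`; `abs_linkVec_chart_sub_le` — `|(linkVec P(y) − chartVec y)_{e,a}| ≤ ρ³/2`;
* `norm_covCurl_linkVec_sub_le` — `‖D_U(linkVec P(y)) − D_U(chartVec y)‖ ≤ 5ρ³√N`;
* ★ `wilsonAction_step_model_ge` / `wilsonAction_step_model_le` — `‖G'‖² − η₁ − θ ≤ S(P(y)·U) ≤ ‖G'‖² + η₂ + θ` with
  `G' = F(U) + D_U(chartVec y)`, `θ = chartErr ρ σ N = 10ρ³√N(√σ + 10ρ√N)` (`= O(β^{−3/2})` at `ρ ≍ β^{−1/2}`);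
* ★★ `transferKernel_step_model_sandwich` —
  `e^{2β|E|} e^{−β‖x‖²} e^{−(β/2)(S(U)+‖F+D_U x‖²+η₂+θ)} ≤ K_β(U, P(y)·U) ≤ e^{2β|E|} e^{−β(1+ρ²)⁻²‖x‖²} e^{−(β/2)(S(U)+‖F+D_U x‖²−η₁−θ)}`, `x = chartVec y`:
  the integrand of `…HarmonicStepIntegral` (kinetic constant `b ∈ {β(1+ρ²)⁻², β}`, potential scale `t = β/2`) up to explicit `e^{±(β/2)(η+θ)}`.

## References
* M. Lüscher, Nucl. Phys. B219 (1983) 233, §3. [Luscher1983]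
* E. Seiler, LNP 159 (1982), §3. [SeilerLNP1982]
-/

noncomputable section

open Real
open Literature.MathematicalPhysics.QuantumFieldTheory
open Literature.MathematicalPhysics.QuantumLattice
open Literature.MathematicalPhysics.QuantumFieldTheory.Balaban1983to89.T4CubeChartGnomonic (gnoPoint)

namespace Summit.QuantumFields.YangMills.Theorems.FemtoTransferGap.TwoLattice.Cov

open Summit.QuantumFields.YangMills.Theorems.FemtoTransferGap
open Summit.QuantumFields.YangMills.Theorems.FemtoTransferGap.TwoLattice
open Summit.QuantumFields.YangMills.Theorems.FemtoTransferGap.TwoLattice.Stiff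
open Summit.QuantumFields.YangMills.Theorems.FemtoTransferGap.TwoLattice.GnChart

variable {L : ℕ} [NeZero L]

/-! ## §1 Vector-part versus gnomonic coordinate of a chart link -/

omit [NeZero L] in
/-- For `P(1,y)` with scalar part `s = (1+|y|²)^{−1/2}`: `1 − s ≤ |y|²/2`. [folklore] -/
theorem one_sub_scalarPart_gnoPoint_le (y : Fin 3 → ℝ) : 1 - scalarPart (gnoPoint y) ≤ (∑ a, y a ^ 2) / 2 := by
  obtain ⟨hs, hsq, -⟩ := gnoPoint_chart y
  set s := scalarPart (gnoPoint y)
  set A := ∑ a, y a ^ 2 with hA_def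
  have hA : 0 ≤ A := Finset.sum_nonneg fun a _ => sq_nonneg _
  by_cases hA2 : 2 ≤ A
  · linarith
  · push Not at hA2
    -- `(1 − A/2)²(1 + A) = 1 − (3/4)A² + A³/4 ≤ 1 = s²(1+A)` for `A ≤ 3`, hence `1 − A/2 ≤ s`
    have h1 : (1 - A / 2) ^ 2 * (1 + A) ≤ s ^ 2 * (1 + A) := by
      rw [hsq, show (1 - A / 2) ^ 2 * (1 + A) = 1 - A ^ 2 * (3 - A) / 4 by ring]
      have : 0 ≤ A ^ 2 * (3 - A) := mul_nonneg (sq_nonneg A) (by linarith)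
      linarith
    have h2 : (1 - A / 2) ^ 2 ≤ s ^ 2 := le_of_mul_le_mul_right h1 (by linarith)
    have h3 : 1 - A / 2 ≤ s := (pow_le_pow_iff_left₀ (by linarith) hs.le two_ne_zero).mp h2
    linarith

omit [NeZero L] in
/-- ★ On the chart ball: `|(linkVec P(y))_{e,a} − (chartVec y)_{e,a}| ≤ ρ³/2` (`Σ_a y_e,a² ≤ ρ²`, `ρ ≥ 0`). [folklore] -/
theorem abs_linkVec_chart_sub_le {ρ : ℝ} (hρ : 0 ≤ ρ) {y : Edge 3 L → Fin 3 → ℝ} (hy : ∀ e, ∑ a, y e a ^ 2 ≤ ρ ^ 2) (e : Edge 3 L) (a : Fin 3) :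
    |linkVec L (latPatternChart L (fun _ => false) y) (e, a) - chartVec y (e, a)| ≤ ρ ^ 3 / 2 := by
  rw [linkVec_apply, chartVec_apply, latPatternChart_false]
  obtain ⟨hs, hsq, hv⟩ := gnoPoint_chart (y e)
  rw [hv a, show scalarPart (gnoPoint (y e)) * y e a - y e a = -((1 - scalarPart (gnoPoint (y e))) * y e a) by ring, abs_neg, abs_mul]
  have h1 := one_sub_scalarPart_gnoPoint_le (y e)
  have hA : 0 ≤ ∑ b, y e b ^ 2 := Finset.sum_nonneg fun b _ => sq_nonneg _
  have hs1 : scalarPart (gnoPoint (y e)) ≤ 1 := by nlinarith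
  rw [abs_of_nonneg (by linarith)]
  have hya : |y e a| ≤ ρ := abs_le_of_sum_sq_le hρ (hy e) a
  calc (1 - scalarPart (gnoPoint (y e))) * |y e a| ≤ (ρ ^ 2 / 2) * ρ :=
        mul_le_mul (h1.trans (by linarith [hy e])) hya (abs_nonneg _) (by positivity)
    _ = ρ ^ 3 / 2 := by ring

/-- ★ `‖D_U(linkVec P(y)) − D_U(chartVec y)‖ ≤ 5ρ³√N`. [cite: Luscher1983, §3] -/
theorem norm_covCurl_linkVec_sub_le (U : GaugeConfig 3 L SU2) {ρ : ℝ} (hρ : 0 ≤ ρ) {y : Edge 3 L → Fin 3 → ℝ}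
    (hy : ∀ e, ∑ a, y e a ^ 2 ≤ ρ ^ 2) :
    ‖covCurl U (linkVec L (latPatternChart L (fun _ => false) y)) - covCurl U (chartVec y)‖ ≤
      5 * ρ ^ 3 * Real.sqrt (Fintype.card (Plaquette 3 L × Fin 3)) := by
  rw [← map_sub]
  have h := norm_covCurl_le U (w := linkVec L (latPatternChart L (fun _ => false) y) - chartVec y) (ρ := ρ ^ 3 / 2) (by positivity)
    fun e b => by rw [PiLp.sub_apply]; exact abs_linkVec_chart_sub_le hρ hy e b
  calc _ ≤ 10 * (ρ ^ 3 / 2) * Real.sqrt (Fintype.card (Plaquette 3 L × Fin 3)) := h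
    _ = _ := by ring

/-! ## §2 The action after the step in the model variable -/

/-- The chart error `θ = 10ρ³√N·(√σ + 10ρ√N)`. [cite: Luscher1983, §3] -/
def chartErr (ρ σ N : ℝ) : ℝ := 10 * ρ ^ 3 * Real.sqrt N * (Real.sqrt σ + 10 * ρ * Real.sqrt N)

section Step

variable {ρ σ : ℝ} (U : GaugeConfig 3 L SU2) (y : Edge 3 L → Fin 3 → ℝ)

/-- `‖F(U) + D_U(chartVec y)‖ ≤ √σ + 10ρ√N`. [cite: Luscher1983, §3] -/
theorem norm_model_le (hρ0 : 0 ≤ ρ) (hS : wilsonAction su2Rep U ≤ σ) (hy : ∀ e, ∑ a, y e a ^ 2 ≤ ρ ^ 2) :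
    ‖plaqCurv U + covCurl U (chartVec y)‖ ≤ Real.sqrt σ + 10 * ρ * Real.sqrt (Fintype.card (Plaquette 3 L × Fin 3)) := by
  refine (norm_add_le _ _).trans (add_le_add (norm_plaqCurv_le_sqrt U hS) (norm_covCurl_le U hρ0 fun e b => ?_))
  rw [chartVec_apply]
  exact abs_le_of_sum_sq_le hρ0 (hy e) b

/-- The two model curvatures differ by `θ` in squared norm: `|‖G‖² − ‖G'‖²| ≤ chartErr ρ σ N`. [cite: Luscher1983, §3] -/
theorem abs_norm_sq_sub_le (hρ0 : 0 ≤ ρ) (hS : wilsonAction su2Rep U ≤ σ) (hy : ∀ e, ∑ a, y e a ^ 2 ≤ ρ ^ 2) :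
    |‖plaqCurv U + covCurl U (linkVec L (latPatternChart L (fun _ => false) y))‖ ^ 2 - ‖plaqCurv U + covCurl U (chartVec y)‖ ^ 2| ≤
      chartErr ρ σ (Fintype.card (Plaquette 3 L × Fin 3)) := by
  set G := plaqCurv U + covCurl U (linkVec L (latPatternChart L (fun _ => false) y))
  set G' := plaqCurv U + covCurl U (chartVec y)
  have hG : ‖G‖ ≤ Real.sqrt σ + 10 * ρ * Real.sqrt (Fintype.card (Plaquette 3 L × Fin 3)) := norm_G_le U y hρ0 hS hy
  have hG' : ‖G'‖ ≤ Real.sqrt σ + 10 * ρ * Real.sqrt (Fintype.card (Plaquette 3 L × Fin 3)) := norm_model_le U y hρ0 hS hy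
  have hd : ‖G - G'‖ ≤ 5 * ρ ^ 3 * Real.sqrt (Fintype.card (Plaquette 3 L × Fin 3)) := by
    have : G - G' = covCurl U (linkVec L (latPatternChart L (fun _ => false) y)) - covCurl U (chartVec y) := by
      simp only [G, G']; abel
    rw [this]; exact norm_covCurl_linkVec_sub_le U hρ0 hy
  have h1 : |‖G‖ - ‖G'‖| ≤ ‖G - G'‖ := abs_norm_sub_norm_le G G'
  rw [sq_sub_sq, abs_mul]
  unfold chartErr
  calc |‖G‖ + ‖G'‖| * |‖G‖ - ‖G'‖|
      ≤ (2 * (Real.sqrt σ + 10 * ρ * Real.sqrt (Fintype.card (Plaquette 3 L × Fin 3)))) *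
          (5 * ρ ^ 3 * Real.sqrt (Fintype.card (Plaquette 3 L × Fin 3))) := by
        refine mul_le_mul ?_ (h1.trans hd) (abs_nonneg _) (by positivity)
        rw [abs_of_nonneg (by positivity)]; linarith
    _ = _ := by ring

/-- ★ **LOWER ACTION BOUND in the model variable**: `‖F + D_U(chartVec y)‖² − η₁ − θ ≤ S(P(y)·U)`. [cite: Luscher1983, §3] -/
theorem wilsonAction_step_model_ge (hρ0 : 0 ≤ ρ) (hρ : ρ ≤ 1 / 30) (hσ : σ ≤ 1 / 16) (hS : wilsonAction su2Rep U ≤ σ)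
    (hy : ∀ e, ∑ a, y e a ^ 2 ≤ ρ ^ 2) :
    ‖plaqCurv U + covCurl U (chartVec y)‖ ^ 2 - stepErrLo ρ σ (Fintype.card (Plaquette 3 L × Fin 3)) -
        chartErr ρ σ (Fintype.card (Plaquette 3 L × Fin 3)) ≤
      wilsonAction su2Rep (latPatternChart L (fun _ => false) y * U) := by
  have h1 := wilsonAction_step_ge U y hρ0 hρ hσ hS hy
  have h2 := abs_norm_sq_sub_le U y hρ0 hS hy
  rw [abs_le] at h2
  linarith [h2.1, h2.2]

/-- ★ **UPPER ACTION BOUND in the model variable**: `S(P(y)·U) ≤ ‖F + D_U(chartVec y)‖² + η₂ + θ` (`ρ ≤ 1/100`). [cite: Luscher1983, §3] -/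
theorem wilsonAction_step_model_le (hρ0 : 0 ≤ ρ) (hρ : ρ ≤ 1 / 100) (hσ : σ ≤ 1 / 16) (hS : wilsonAction su2Rep U ≤ σ)
    (hy : ∀ e, ∑ a, y e a ^ 2 ≤ ρ ^ 2) :
    wilsonAction su2Rep (latPatternChart L (fun _ => false) y * U) ≤
      ‖plaqCurv U + covCurl U (chartVec y)‖ ^ 2 + stepErrUp ρ σ (Fintype.card (Plaquette 3 L × Fin 3)) +
        chartErr ρ σ (Fintype.card (Plaquette 3 L × Fin 3)) := by
  have h1 := wilsonAction_step_le U y hρ0 hρ hσ hS hy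
  have h2 := abs_norm_sq_sub_le U y hρ0 hS hy
  rw [abs_le] at h2
  linarith [h2.1, h2.2]

/-! ## §3 The kernel as a Gaussian model in `x = chartVec y` -/

/-- ★★ **THE KERNEL ALONG A NEAR STEP IS A GAUSSIAN MODEL IN `x = chartVec y`**: for `β ≥ 0`, `0 ≤ ρ ≤ 1/100`, `σ ≤ 1/16`, `S(U) ≤ σ`,
`|y_e|² ≤ ρ²`: with `x = chartVec y`, `N = 3|P|`, `η₁ = stepErrLo`, `η₂ = stepErrUp`, `θ = chartErr`,
`e^{2β|E|} e^{−β‖x‖²} e^{−(β/2)(S(U)+‖F(U)+D_U x‖²+η₂+θ)} ≤ K_β(U, P(y)·U) ≤ e^{2β|E|} e^{−β(1+ρ²)⁻²‖x‖²} e^{−(β/2)(S(U)+‖F(U)+D_U x‖²−η₁−θ)}`.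
[cite: Luscher1983, §3] [cite: SeilerLNP1982, §3] -/
theorem transferKernel_step_model_sandwich {β : ℝ} (hβ : 0 ≤ β) (hρ0 : 0 ≤ ρ) (hρ : ρ ≤ 1 / 100) (hσ : σ ≤ 1 / 16)
    (hS : wilsonAction su2Rep U ≤ σ) (hy : ∀ e, ∑ a, y e a ^ 2 ≤ ρ ^ 2) :
    Real.exp (2 * β) ^ Fintype.card (Edge 3 L) * Real.exp (-(β * ‖chartVec y‖ ^ 2)) *
        Real.exp (-(β / 2) * (wilsonAction su2Rep U + (‖plaqCurv U + covCurl U (chartVec y)‖ ^ 2 +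
          stepErrUp ρ σ (Fintype.card (Plaquette 3 L × Fin 3)) + chartErr ρ σ (Fintype.card (Plaquette 3 L × Fin 3))))) ≤
      transferKernel su2Rep β U (latPatternChart L (fun _ => false) y * U) ∧
    transferKernel su2Rep β U (latPatternChart L (fun _ => false) y * U) ≤
      Real.exp (2 * β) ^ Fintype.card (Edge 3 L) * Real.exp (-(β / (1 + ρ ^ 2) ^ 2 * ‖chartVec y‖ ^ 2)) *
        Real.exp (-(β / 2) * (wilsonAction su2Rep U + (‖plaqCurv U + covCurl U (chartVec y)‖ ^ 2 -
          stepErrLo ρ σ (Fintype.card (Plaquette 3 L × Fin 3)) - chartErr ρ σ (Fintype.card (Plaquette 3 L × Fin 3))))) := by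
  obtain ⟨hk1, hk2⟩ := transferKernel_step_chart_sandwich U y hβ hρ0 hρ hσ hS hy
  have h2 := abs_norm_sq_sub_le U y hρ0 hS hy
  rw [abs_le] at h2
  rw [norm_chartVec_sq]
  have hβ2 : 0 ≤ β / 2 := by linarith
  constructor
  · refine le_trans ?_ hk1
    refine mul_le_mul_of_nonneg_left (Real.exp_le_exp.mpr ?_) (by positivity)
    nlinarith [h2.1, h2.2]
  · refine hk2.trans ?_
    refine mul_le_mul_of_nonneg_left (Real.exp_le_exp.mpr ?_) (by positivity)
    nlinarith [h2.1, h2.2]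

end Step

end Summit.QuantumFields.YangMills.Theorems.FemtoTransferGap.TwoLattice.Cov

end
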